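import Summits.NavierStokesRegularity.NavierStokesRegularity.Theorems.StrainDoorsTypeITangentVorticityEq
import HarnessLib

/-!
# Strain doors, PART I — the vorticity record law on the tangent field (ROUND 58 of the ns-regularity-ideate cell, second half)

(Tree file 2 of 2 of PART I — §I3, the record law; §I1–§I2 are in `StrainDoorsTypeITangentVorticityEq`.
Text of nsreg-p1 g35 r58/StrainDoorsTypeITangentLaw.lean sha256 c4a91e49e5e56002, split at the 400-line cap,
bodies verbatim.)

For every classical Type-I solution `(u,p)` of Navier–Stokes on `(−∞,0) × ℝ³` with `ω ≢ 0`, the tangent field `v`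
of PART H (`typeI_tangent_vorticity_attains`) — continuous, Type-I, bounded-weak ancient, with the vorticity number
`W* = sup (0−s)|ω|` of `u` ATTAINED at `(−1, z̄)` — has `C^∞` slices and satisfies the vorticity equation
POINTWISE with a classical time derivative on `s ≤ −1/2` (`tangent_vorticity_eq`: KNSS's window representative
`v = U + b(t)` has a drift with the CONTINUOUS representative `b̃ = v(·,0) − U(·,0)`, `v = U + b̃` at every time,
the integrated vorticity identity of `KNSS2009_regularity_boundedWeak_window_holds` has a continuous integrand, FTC),
and therefore the VORTICITY RECORD LAW WITH LAPLACIAN CREDIT holds at `(−1, z̄)`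
(`typeI_tangent_vorticity_record_law`): `1 ≤ (0 − (−1))(⟪ξ̄, ∇v ξ̄⟫ − |∇ξ̄|²_F)` — the conclusion of door D14's
consumer `typeI_vorticity_law_on_tangent_flow` (PART F), now UNCONDITIONAL (with the honest regularity of the
tangent field in place of "classical").

References: Koch–Nadirashvili–Seregin–Šverák, Acta Math. 203 (2009), §4 (4.11), Lemma 3.1, §6 [KNSS2009];
Giga–Gu–Hsu, Nonlinear Anal. 189 (2019) 111579, §2 (blow-up limits normalised by velocity).
-/

noncomputable section

open MeasureTheory Set Function Filter Metric Real InnerProductSpace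
open _root_.Topology
open scoped ENNReal NNReal RealInnerProductSpace ContDiff Laplacian
open Literature.Analysis Literature.Analysis.FluidPDE
open Literature.Analysis.FluidPDE.VorticityDirectionDynamics

set_option linter.unusedVariables false
set_option linter.unusedSectionVars false

namespace Summit.NavierStokesRegularity.NavierStokesRegularity.Theorems.StrainDoors

open Summit.NavierStokesRegularity.NavierStokesRegularity.Theorems.ArgmaxDoors

/-! ## §I3 The record law on the tangent field — door D14's consumer, unconditionally -/

/-- The left Fermat inequality at a running record of `(T − s)|ω(s)|` for a curve `ω` with a classical derivative
at `t`: `|ω(t)|² ≤ (T − t)⟪ω(t), ω'(t)⟫`. [folklore] -/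
theorem fermat_left_of_hasDerivAt {om : ℝ → (EuclideanSpace ℝ (Fin 3))} {D : EuclideanSpace ℝ (Fin 3)} {t T : ℝ}
    (hd : HasDerivAt om D t) (htT : t < T)
    (hrec : IsLocalMaxOn (fun s => (T - s) * ‖om s‖) (Iic t) t) :
    ‖om t‖ ^ 2 ≤ (T - t) * ⟪om t, D⟫ := by
  have hTt : 0 < T - t := sub_pos.mpr htT
  have hg : HasDerivAt (fun s => ‖om s‖ ^ 2) (2 * ⟪om t, D⟫) t := hd.norm_sq
  have hl : HasDerivAt (fun s : ℝ => T - s) (-1) t := by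
    simpa using (hasDerivAt_id t).const_sub T
  have hF : HasDerivAt (fun s => (T - s) * (T - s) * ‖om s‖ ^ 2)
      ((-1 * (T - t) + (T - t) * -1) * ‖om t‖ ^ 2 + (T - t) * (T - t) * (2 * ⟪om t, D⟫)) t :=
    (hl.mul hl).mul hg
  have hrecF : IsLocalMaxOn (fun s => (T - s) * (T - s) * ‖om s‖ ^ 2) (Iic t) t := by
    show ∀ᶠ s in 𝓝[Iic t] t, (T - s) * (T - s) * ‖om s‖ ^ 2 ≤ (T - t) * (T - t) * ‖om t‖ ^ 2
    filter_upwards [hrec, self_mem_nhdsWithin] with s hs hsle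
    have hsT : s < T := lt_of_le_of_lt hsle htT
    have h0 : 0 ≤ (T - s) * ‖om s‖ := mul_nonneg (sub_pos.mpr hsT).le (norm_nonneg _)
    have h2 := mul_self_le_mul_self h0 hs
    have e1 : ∀ r : ℝ, (T - r) * ‖om r‖ * ((T - r) * ‖om r‖) = (T - r) * (T - r) * ‖om r‖ ^ 2 :=
      fun r => by ring
    rw [e1, e1] at h2
    exact h2
  have hnn := hasDerivAt_nonneg_of_isLocalMaxOn_Iic hrecF hF
  have key : ‖om t‖ ^ 2 * (T - t) ≤ (T - t) * ⟪om t, D⟫ * (T - t) := by linarith [hnn]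
  exact le_of_mul_le_mul_right key hTt

/-- ★★★ **THE VORTICITY RECORD LAW ON THE TANGENT FIELD (door D14's consumer — unconditional).**  For every
classical solution `(u,p)` of Navier–Stokes (`ν = 1`) on `(−∞,0) × ℝ³` with the Type-I bound
`|u(t,x)| ≤ C₀/(|x| + √(−t))` and `ω ≢ 0` there are a TANGENT FIELD `v` — the pointwise limit, with vorticities, of
parabolic rescalings `λ_j u(λ_j² s, λ_j y)` of `u` on `s ≤ −1/4`, continuous, Type-I, `t ↦ v(t − 1/4)` a bounded
weak ancient solution, with `C^∞` slices and the vorticity equation holding pointwise on `s ≤ −1/2` — and a point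
`z̄` such that `ω_v(−1, z̄) ≠ 0`, `(0 − (−1))|ω_v(−1, z̄)|` DOMINATES `(0 − s)|ω(s,y)|` for all `s < 0` and
`(0 − s)|ω_v(s,y)|` for all `s ≤ −1/4`, and AT `(−1, z̄)`:
`1 ≤ (0 − (−1))·(⟪ξ̄, ∇v ξ̄⟫ − |∇ξ̄|²_F)` and `1 + (0 − (−1))|∇ξ̄|²_F ≤ (0 − (−1))·q_v(ξ̄)` — stretching along the
limiting vorticity direction beats the clock plus the twist, ON THE TANGENT FIELD OF AN ARBITRARY TYPE-I SOLUTION.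
(PART G recentring + PART H tangent field and attainment + §I2 pointwise vorticity equation + left Fermat +
`inner_vorticity_rhs_le_at_argmax`.) [new-combination] -/
theorem typeI_tangent_vorticity_record_law {C₀ : ℝ}
    {u : ℝ → (EuclideanSpace ℝ (Fin 3)) → (EuclideanSpace ℝ (Fin 3))} {p : ℝ → (EuclideanSpace ℝ (Fin 3)) → ℝ}
    (hsol : IsClassicalNSSolutionOn (Iio 0) 1 0 u p) (hI : HasTypeIDecay C₀ u)
    (hcurl : ∃ t₀ : ℝ, t₀ < 0 ∧ ∃ x₀ : EuclideanSpace ℝ (Fin 3), curl (u t₀) x₀ ≠ 0) :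
    ∃ (v : ℝ → (EuclideanSpace ℝ (Fin 3)) → (EuclideanSpace ℝ (Fin 3))) (zbar : EuclideanSpace ℝ (Fin 3)),
      Continuous (uncurry v) ∧
      (∃ lam : ℕ → ℝ, (∀ j, 0 < lam j) ∧ ∀ t ≤ -(1/4 : ℝ), ∀ x,
          Tendsto (fun j => nsRescale (lam j) u t x) atTop (𝓝 (v t x)) ∧
          Tendsto (fun j => curl (nsRescale (lam j) u t) x) atTop (𝓝 (curl (v t) x))) ∧
      (∀ t ≤ -(1/4 : ℝ), ∀ x, ‖v t x‖ ≤ C₀ / (‖x‖ + √(-t))) ∧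
      IsBoundedWeakNSSolutionOn (Iio 0) isOpen_Iio 1 (fun t => v (t - 1/4)) ∧
      (∀ t ≤ -(1/2 : ℝ), ContDiff ℝ ∞ (v t)) ∧
      (∀ t ≤ -(1/2 : ℝ), ∀ x, HasDerivAt (fun s => curl (v s) x)
          ((Δ (curl (v t))) x - fderiv ℝ (curl (v t)) x (v t x) + fderiv ℝ (v t) x (curl (v t) x)) t) ∧
      curl (v (-1)) zbar ≠ 0 ∧
      (∀ s : ℝ, s < 0 → ∀ y, (0 - s) * ‖curl (u s) y‖ ≤ (0 - (-1)) * ‖curl (v (-1)) zbar‖) ∧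
      (∀ s ≤ -(1/4 : ℝ), ∀ y, (0 - s) * ‖curl (v s) y‖ ≤ (0 - (-1)) * ‖curl (v (-1)) zbar‖) ∧
      1 ≤ (0 - (-1)) *
          (⟪vorticityDirection (curl (v (-1))) zbar,
              fderiv ℝ (v (-1)) zbar (vorticityDirection (curl (v (-1))) zbar)⟫ -
            frobeniusNormSq (fderiv ℝ (vorticityDirection (curl (v (-1)))) zbar)) ∧
      1 + (0 - (-1)) * frobeniusNormSq (fderiv ℝ (vorticityDirection (curl (v (-1)))) zbar) ≤
          (0 - (-1)) * strainQuad v (-1) zbar (vorticityDirection (curl (v (-1))) zbar) := by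
  obtain ⟨W, hW, hnum, -, lam, hlam, v, zbar, hvc, hconv, -, -, hcurlc, hTypeI, hweak, -, hnumv, hatt⟩ :=
    typeI_tangent_vorticity_attains hsol hI hcurl
  have hwin := fun t (ht : t ≤ -(1/2 : ℝ)) (x : EuclideanSpace ℝ (Fin 3)) =>
    tangent_vorticity_eq hvc hTypeI hweak ht x
  have eW : (0 - (-1 : ℝ)) * ‖curl (v (-1)) zbar‖ = W := by rw [hatt]; ring
  have hne : curl (v (-1)) zbar ≠ 0 := by
    rw [← norm_pos_iff, hatt]; exact hW
  have hmaxX : ∀ y, ‖curl (v (-1)) y‖ ≤ ‖curl (v (-1)) zbar‖ := fun y => by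
    have h := hnumv (-1) (by norm_num) y
    rw [hatt]; linarith
  have hrec : IsLocalMaxOn (fun s => (0 - s) * ‖curl (v s) zbar‖) (Iic (-1)) (-1) := by
    show ∀ᶠ s in 𝓝[Iic (-1)] (-1), (0 - s) * ‖curl (v s) zbar‖ ≤ (0 - (-1)) * ‖curl (v (-1)) zbar‖
    filter_upwards [self_mem_nhdsWithin] with s hs
    rw [eW]
    exact hnumv s (by linarith [mem_Iic.1 hs]) zbar
  -- the vorticity equation at `(-1, zbar)` with a classical time derivative
  obtain ⟨hsm, hD⟩ := hwin (-1) (by norm_num) zbar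
  have hferm := fermat_left_of_hasDerivAt hD (by norm_num : (-1 : ℝ) < 0) hrec
  have heq : ((Δ (curl (v (-1)))) zbar - fderiv ℝ (curl (v (-1))) zbar (v (-1) zbar) +
        fderiv ℝ (v (-1)) zbar (curl (v (-1)) zbar)) + convect (v (-1)) (curl (v (-1))) zbar =
      convect (curl (v (-1))) (v (-1)) zbar + (1 : ℝ) • (Δ (curl (v (-1)))) zbar := by
    simp only [convect_apply, one_smul]; abel
  have hinner := inner_vorticity_rhs_le_at_argmax zero_le_one hsm hmaxX hne heq
  obtain ⟨r, hrdef⟩ : ∃ r : ℝ, r =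
      ⟪vorticityDirection (curl (v (-1))) zbar,
          fderiv ℝ (v (-1)) zbar (vorticityDirection (curl (v (-1))) zbar)⟫ -
        1 * frobeniusNormSq (fderiv ℝ (vorticityDirection (curl (v (-1)))) zbar) := ⟨_, rfl⟩
  rw [← hrdef] at hinner
  have hpos : 0 < ‖curl (v (-1)) zbar‖ ^ 2 := pow_pos (norm_pos_iff.mpr hne) 2
  have h01 : (0 : ℝ) < 0 - (-1) := by norm_num
  have h3 : ‖curl (v (-1)) zbar‖ ^ 2 ≤ (0 - (-1)) * (r * ‖curl (v (-1)) zbar‖ ^ 2) :=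
    hferm.trans (mul_le_mul_of_nonneg_left hinner h01.le)
  have h4 : 1 * ‖curl (v (-1)) zbar‖ ^ 2 ≤ (0 - (-1)) * r * ‖curl (v (-1)) zbar‖ ^ 2 := by
    rw [one_mul, mul_assoc]; exact h3
  have hlaw : 1 ≤ (0 - (-1)) * r := le_of_mul_le_mul_right h4 hpos
  rw [hrdef, one_mul] at hlaw
  have hq : strainQuad v (-1) zbar (vorticityDirection (curl (v (-1))) zbar) =
      ⟪vorticityDirection (curl (v (-1))) zbar,
        fderiv ℝ (v (-1)) zbar (vorticityDirection (curl (v (-1))) zbar)⟫ := by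
    unfold strainQuad; exact real_inner_comm _ _
  refine ⟨v, zbar, hvc, ⟨lam, hlam, fun t ht x => ⟨hconv t ht x, hcurlc t ht x⟩⟩, hTypeI, hweak,
    fun t ht => (hwin t ht 0).1, fun t ht x => (hwin t ht x).2, hne,
    fun s hs y => eW ▸ hnum s hs y, fun s hs y => eW ▸ hnumv s hs y, hlaw, ?_⟩
  rw [hq]
  nlinarith [hlaw]

end Summit.NavierStokesRegularity.NavierStokesRegularity.Theorems.StrainDoors

end
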